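import Summits.QuantumFields.BalabanUV.Beta.EriceFlowEnclosureB12AsPrintedPointwiseFadingOrder
import Summits.QuantumFields.BalabanUV.Beta.EriceFlowEnclosureB12AsPrintedHistoryNonuniqueEnd
import Summits.QuantumFields.BalabanUV.Beta.EriceFlowEnclosureB12AsPrintedPointwiseSizeWitness

/-!
# Beta / EriceFlowEnclosureB12AsPrintedPointwiseFadingOrderEnd — WHAT (0.31) FORCES POINTWISE, part 7 END: the two LOAD-BEARING LETTERS for the
# uniqueness of Theorem 2's bare coupling, read off part 7 (`…PointwiseFadingOrder`: under coupling-chart moduli with FADING memory θ < 1, same-length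
# uniqueness and the order of the couplings are FREE — no asymptotic freedom, no sign, no Theorem 2) against the two witnesses already in the tree:
# (1) prover 1's θ = 1 bump family (gen 34, #62d `exists_twoRuns_uniformModulus`: a UNIFORM coordinatewise modulus `FadingMemory C 1 Λ`, the AF letter
# `BetaLowerH b` at EVERY box, and TWO same-length runs pinned at one renormalized coupling, at every box size) ⟹ **`sameLength_rate_dichotomy`**: the RATE
# θ < 1 of node U2's `FadingMemory` — not asymptotic freedom — is the exact load-bearing letter for «g₀ = g₀(ε, g) is a function»; (2) part 3's g² toy (gen 42,
# #59e `…PointwiseSizeWitness`: [I]'s whole typed content, THEOREM 2 AS TYPED, the g-UNIFORM form of (0.31) FALSE) lies INSIDE part 7's regime (last-only modulus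
# with constant 1 on ]0, ½]) ⟹ **`uniformReading_idle_for_uniqueness`**: on ONE setting the typed Theorem 2 holds, its uniform reading fails, and «∃! g₀»
# holds on every lattice — the placement of «there exist constants β, β′» after «for a sufficiently small positive g» (p. 259) is load-bearing for the SIZE
# of β near zero coupling (#59e) and IDLE for uniqueness; (3) **`theorem2_bareCoupling_strictMono_signFree`**: «g₀(ε, ·)» is a STRICTLY INCREASING function
# on ]0, g₁], on every lattice, from the typed Theorem 2 + `Definitions` + (U) + the moduli — prover 1's `theorem2_bareCoupling_lipschitz` (#62g: monotone and
# 2-Lipschitz under the AF letters) keeps its Lipschitz half as the AF content; sign-free one has only the lattice-wise modulus `inv_sq_bare_le_of_end`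
# (constant (2∕(1+θ))^K in the 1∕g² chart)
# (β-flow team, prover 2 = lower ∕ positivity side, unit `b2b-balaban-beta-bflow-p2`, gen 44; ROW AP-I × node U2's letters; companion of part 7)

HONEST FRAMING (page 1 of everything the β sub-cell writes): discharging `BetaPertH` makes Bałaban's UV stability UNCONDITIONAL — a
real constructive-QFT result; it is NOT the continuum limit and NOT the Clay problem.  HONEST DEPENDENCY (cell reorg 2026-08-19,
verbatim): «continuum YM on T⁴ ⇐ BetaPertH ∧ nine spine estimates (0/9 proved); BetaPertH ⇐ (D1) ∧ (D4) ∧ CAP+tail; G-an2-4 gates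
asym, D1 and NE2/3/4.»  THIS MODULE DISCHARGES NOTHING: bookkeeping over part 7, prover 1's β-level witness family (OURS, not Bałaban's) and
part 3's toy setting (OURS) of the statement-exact typing `B12BetaAsPrinted` of [I] = T. Bałaban, Commun. Math. Phys. **109** (1987) [Balaban1987RG1];
`Theorem2Statement` (STATED WITHOUT PROOF, p. 259; [Balaban1989LargeFieldII] p. 355) is a HYPOTHESIS in §3 and PROVED FOR THE TOY in §2; node U2's
`HistLipschitz` ∕ `FadingMemory` ∕ `LastOnlyLipschitz` are HYPOTHESIS SHAPES, NOT printed ([I] p. 298 states the history dependence only; GAPS G-t4-U2-2);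
uniqueness of g₀ is NOT printed in [I] (custodian's DELTA-I D-21).  Nothing of Bałaban's (1.22) is asserted.

WHAT THIS FILE PROVES (0 sorry, 0 def):
§1 **`sameLength_rate_dichotomy`** (θ < 1: unique at every depth, sign-free — part 7; θ = 1: two runs at every box size WITH the AF letter — prover 1 #62d).
§2 `lastOnly_sq` (the g² family has the last-only modulus 1 on ]0, ½]), **`uniformReading_idle_for_uniqueness`** (ONE setting: typed Theorem 2 ✓, uniform
   form ✗, moduli ✓, «∃! g₀» on every lattice ✓ by part 7's END at θ = 0, C = 1, γ₁ = ½).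
§3 `inv_sq_bare_le_of_end` (lattice-wise modulus of the inverse map), **`theorem2_bareCoupling_strictMono_signFree`** («g₀(ε, ·)» exists, is unique and
   strictly increasing — sign-free).
NOT CLAIMED: that either toy resembles Bałaban's β; which reading print intends; Theorem 2; `BetaPertH`; continuum; Clay.
-/

namespace Summit.QuantumFields.BalabanUV.Beta.EriceFlowEnclosureB12AsPrintedPointwiseFadingOrderEnd

open Finset
open Literature.MathematicalPhysics.QuantumFieldTheory.Balaban1983to89
open Literature.MathematicalPhysics.QuantumFieldTheory.Balaban1983to89.B12BetaAsPrinted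
open Literature.MathematicalPhysics.QuantumFieldTheory.Balaban1983to89.FlowStep (HBeta prefixOf Box mem_box box_mono RGEqH BetaUpperH
  BetaLowerH BetaAFH)
open Literature.MathematicalPhysics.QuantumFieldTheory.Balaban1983to89.T4CouplingMatching (HistLipschitz FadingMemory LastOnlyLipschitz
  fadingMemory_diag histLipschitz_of_lastOnly)
open Summit.QuantumFields.BalabanUV.Beta.EriceFlowEnclosure (ofErice)
open Summit.QuantumFields.BalabanUV.Beta.EriceFlowEnclosureB12AsPrintedUpper (tunedRuns_of_theorem2Statement)
open Summit.QuantumFields.BalabanUV.Beta.EriceFlowEnclosureB12AsPrintedTunedUpper (hrg_of_betaUpperH)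
open Summit.QuantumFields.BalabanUV.Beta.EriceFlowEnclosureB12AsPrintedHistoryNonuniqueEnd (exists_twoRuns_uniformModulus)
open Summit.QuantumFields.BalabanUV.Beta.EriceFlowEnclosureB12AsPrintedPointwiseSizeWitness (beta_eq letters_sq theorem2_not_uniform_sq sqToy_exists)
open Summit.QuantumFields.BalabanUV.Beta.EriceFlowEnclosureB12AsPrintedPointwiseFadingOrder

noncomputable section

/-! ## §1 The rate of the memory is the load-bearing letter: θ < 1 (free uniqueness) against θ = 1 (prover 1's two runs WITH asymptotic freedom) -/

/-- **THE SAME-LENGTH RATE DICHOTOMY.**  (i) θ < 1: for EVERY history-dependent β with coupling-chart moduli `HistLipschitz Λ γ β`, `FadingMemory C θ Λ`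
(0 ≤ θ < 1, 0 ≤ C) on a box with `4Cγ³ ≤ (1 − θ)²`, two same-length runs of (0.20) in ]0, γ] pinned at one renormalized coupling COINCIDE — no sign, no
asymptotic freedom, any depth (part 7 `runs_eq_of_fadingMemory_signFree`); (ii) θ = 1: for EVERY b, C, γ > 0 and EVERY box size g ≤ γ there are a β with the
AF letter `BetaLowerH b` on EVERY box, a UNIFORM modulus `HistLipschitz Λ` with `FadingMemory C 1 Λ`, and TWO same-length runs of (0.20) in ]0, g] with
DIFFERENT bare couplings and the SAME renormalized coupling g (prover 1's bump family, #62d `exists_twoRuns_uniformModulus`, projected).  So for «g₀ = g₀(ε, g) is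
a function» the rate θ < 1 is load-bearing and asymptotic freedom is not. [cite: Balaban1987RG1, Thm 2 p.259 («g₀ = g₀(ε, g)») with (0.20) p.256 and p.298] -/
theorem sameLength_rate_dichotomy :
    (∀ (β : HBeta) (Λ : ℕ → ℕ → ℝ) (γ θ C : ℝ) (K : ℕ) (g g' : ℕ → ℝ),
      0 ≤ θ → θ < 1 → 0 ≤ C → 4 * C * γ ^ 3 ≤ (1 - θ) ^ 2 → HistLipschitz Λ γ β → FadingMemory C θ Λ →
      RGEqH K β g → RGEqH K β g' → (∀ i, i ≤ K → 0 < g i ∧ g i ≤ γ) → (∀ i, i ≤ K → 0 < g' i ∧ g' i ≤ γ) →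
      g K = g' K → ∀ j, j ≤ K → g j = g' j) ∧
    (∀ b C γ g : ℝ, 0 < b → 0 < C → 0 < γ → 0 < g → g ≤ γ →
      ∃ (β : HBeta) (Λ : ℕ → ℕ → ℝ) (K : ℕ) (gA gB : ℕ → ℝ),
        (∀ γ', BetaLowerH b γ' β) ∧ (∀ γ', HistLipschitz Λ γ' β) ∧ FadingMemory C 1 Λ ∧
        RGEqH K β gA ∧ RGEqH K β gB ∧ (∀ i, i ≤ K → 0 < gA i ∧ gA i ≤ g) ∧ (∀ i, i ≤ K → 0 < gB i ∧ gB i ≤ g) ∧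
        gA K = g ∧ gB K = g ∧ gA 0 ≠ gB 0) := by
  refine ⟨fun β Λ γ θ C K g g' hθ0 hθ1 hC hsmall hL hΛ hg hg' hbox hbox' hpin =>
    runs_eq_of_fadingMemory_signFree hθ0 hθ1 hC hg hg' hbox hbox' hL hΛ hsmall hpin, fun b C γ g hb hC hγ hg hgγ => ?_⟩
  obtain ⟨β, Λ, K, gA, gB, hlo, -, hL, hΛ, -, -, -, -, hrgA, hrgB, hboxA, hboxB, hendA, hendB, hlt, -⟩ :=
    exists_twoRuns_uniformModulus (a := b) (Cp := 1) hb hC hb one_pos hγ hg hgγ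
  exact ⟨β, Λ, K, gA, gB, hlo, hL, hΛ, hrgA, hrgB, hboxA, hboxB, hendA, hendB, ne_of_gt hlt⟩

/-! ## §2 One setting: Theorem 2 AS TYPED ✓, its g-uniform form ✗, the moduli ✓ — and «∃! g₀» ✓: the uniform reading is idle for uniqueness -/

section SqToy

variable {βE : ℕ → ℝ → ℝ} (hE : ∀ (n : ℕ) (s : ℝ), βE n s = if n = 0 then -s else -1)
include hE

variable {S : Setting}

/-- Part 3's g² family (β_1(g₀) = g₀², β_{k+1} ≡ 1) has node U2's LAST-ONLY modulus with constant 1 on ]0, ½] (|p² − q²| = |p + q||p − q| ≤ |p − q| for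
p, q ∈ ]0, ½]) — hence `HistLipschitz` with the diagonal Λ and `FadingMemory 1 θ` for every θ ≥ 0 (`T4CouplingMatching.histLipschitz_of_lastOnly`,
`fadingMemory_diag`): the toy lies inside part 7's regime. [folklore] -/
theorem lastOnly_sq (hβ : S.β = ofErice βE) : LastOnlyLipschitz 1 (1 / 2) S.β := by
  intro k p q hp hq
  rw [beta_eq hE hβ, beta_eq hE hβ]
  split_ifs with hk
  · have hp' := (mem_box.mp hp) (Fin.last k)
    have hq' := (mem_box.mp hq) (Fin.last k)
    have e : p (Fin.last k) ^ 2 - q (Fin.last k) ^ 2 = (p (Fin.last k) + q (Fin.last k)) * (p (Fin.last k) - q (Fin.last k)) := by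
      ring
    rw [e, abs_mul, abs_of_pos (by linarith [hp'.1, hq'.1] : 0 < p (Fin.last k) + q (Fin.last k))]
    exact mul_le_mul_of_nonneg_right (by linarith [hp'.2, hq'.2]) (abs_nonneg _)
  · simp

end SqToy

/-- **THE UNIFORM READING IS IDLE FOR UNIQUENESS (and load-bearing for size) — ON ONE SETTING.**  There is a setting of [I] as typed with the standing
hypotheses, the printed `Definitions` and `Conclusions`, THEOREM 2 AS TYPED (`Theorem2Statement`: «∃ β, β′» after «∀ g»), whose g-UNIFORM form of (0.31) is
FALSE (part 3's g² toy, #59e `theorem2_not_uniform_sq`: the lower constant min(½, 1∕x₀(g)) → 0), carrying node U2's last-only modulus with constant 1 on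
]0, ½] (hence `HistLipschitz` with the diagonal Λ and `FadingMemory 1 0 Λ`) and the upper letter (U) — and on which, for every m, small γ, small g and EVERY K,
there is EXACTLY ONE bare coupling with an in-interval run ending at g (part 7's END `theorem2_existsUnique_of_fadingMemory_signFree` at θ = 0, C = 1, γ₁ = ½:
1·(½)² < 1, 4·1·(½)³ ≤ 1).  The unit's gen-43 OPEN (b), closed: the placement of «there exist constants β, β′» (p. 259) decides the SIZE letter `BetaAFH` (#59e) and
NOT the uniqueness of g₀. [cite: Balaban1987RG1, Thm 2 (0.31) p.259 with (0.20) p.256] -/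
theorem uniformReading_idle_for_uniqueness :
    ∃ (S : Setting) (hH : StandingHypotheses S), Definitions S ∧ Conclusions S ∧ Theorem2Statement S (hL_of_standing hH) ∧
      (¬ ∀ m : ℕ, ∃ γ₀ : ℝ, 0 < γ₀ ∧ ∀ γ : ℝ, 0 < γ → γ ≤ γ₀ → ∃ g₁ : ℝ, 0 < g₁ ∧ ∃ β β' : ℝ, 0 < β ∧ β ≤ β' ∧
        ∀ g : ℝ, 0 < g → g ≤ g₁ → ∀ K : ℕ, ∃ g₀ : ℝ, Step.InInterval γ K (S.cpl ⟨K, m, g₀⟩) ∧ S.cpl ⟨K, m, g₀⟩ K = g ∧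
          Step.Discrete031 (β * Real.log S.L) (β' * Real.log S.L) K g (S.cpl ⟨K, m, g₀⟩)) ∧
      ¬ BetaAFH S.β ∧ LastOnlyLipschitz 1 (1 / 2) S.β ∧
      (HistLipschitz (fun k i => if i = k then (1 : ℝ) else 0) (1 / 2) S.β ∧ FadingMemory 1 0 (fun k i => if i = k then (1 : ℝ) else 0)) ∧
      BetaUpperH 1 (1 / 2) S.β ∧
      ∀ m : ℕ, ∃ γ₂ : ℝ, 0 < γ₂ ∧ ∀ γ : ℝ, 0 < γ → γ ≤ γ₂ → ∃ g₁ : ℝ, 0 < g₁ ∧ ∀ g : ℝ, 0 < g → g ≤ g₁ → ∀ K : ℕ,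
        ∃! g₀ : ℝ, Step.InInterval γ K (S.cpl ⟨K, m, g₀⟩) ∧ S.cpl ⟨K, m, g₀⟩ K = g := by
  have hE : ∀ (n : ℕ) (s : ℝ), (fun (n : ℕ) (s : ℝ) => if n = 0 then -s else (-1 : ℝ)) n s = if n = 0 then -s else -1 :=
    fun _ _ => rfl
  obtain ⟨S, hβ, -, -, hH, hD, hC, hnaf⟩ := sqToy_exists hE
  obtain ⟨hT, hnu⟩ := theorem2_not_uniform_sq hE hβ hH hD
  obtain ⟨hU, -, -, -, -⟩ := letters_sq hE hβ hD
  have hlast : LastOnlyLipschitz 1 (1 / 2) S.β := lastOnly_sq hE hβ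
  have hhist := histLipschitz_of_lastOnly hlast
  have hfad : FadingMemory 1 0 (fun k i => if i = k then (1 : ℝ) else 0) := fadingMemory_diag zero_le_one le_rfl
  refine ⟨S, hH, hD, hC, hT, hnu, hnaf, hlast, ⟨hhist, hfad⟩, hU, fun m => ?_⟩
  exact theorem2_existsUnique_of_fadingMemory_signFree hT hD hU hhist hfad le_rfl zero_lt_one zero_le_one
    (by norm_num : (0 : ℝ) < 1 / 2) le_rfl (by norm_num) (by norm_num) m

/-! ## §3 «g₀(ε, ·)» is a strictly increasing function — sign-free; its only sign-free modulus is lattice-wise -/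

variable {S : Setting}

/-- **THE LATTICE-WISE MODULUS OF THE INVERSE MAP** (β-level, any history-dependent β): under part 7's hypotheses, for two same-length in-box runs with g_0 ≤ g′_0,
`1∕g_0² − 1∕g′_0² ≤ (2∕(1+θ))^K·(1∕g_K² − 1∕g′_K²)` — the bare couplings are Lipschitz in the renormalized ones in the 1∕g² chart ON EVERY LATTICE, with a constant
that degenerates as K → ∞ (part 7 `sep_lower` read backward).  The K-UNIFORM 2-Lipschitz modulus of prover 1's #62g `runs_lipschitz_of_fadingMemory` is where the
AF letter genuinely enters. [cite: Balaban1987RG1, Thm 2 p.259 («g₀ = g₀(ε, g)») with (0.20) p.256 and p.298] -/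
theorem inv_sq_bare_le_of_end {β : HBeta} {γ θ C : ℝ} {Λ : ℕ → ℕ → ℝ} {K : ℕ} {g g' : ℕ → ℝ}
    (hθ0 : 0 ≤ θ) (hθ1 : θ < 1) (hC : 0 ≤ C) (hg : RGEqH K β g) (hg' : RGEqH K β g')
    (hbox : ∀ i, i ≤ K → 0 < g i ∧ g i ≤ γ) (hbox' : ∀ i, i ≤ K → 0 < g' i ∧ g' i ≤ γ)
    (hL : HistLipschitz Λ γ β) (hΛ : FadingMemory C θ Λ) (hsmall : 4 * C * γ ^ 3 ≤ (1 - θ) ^ 2) (h0 : g 0 ≤ g' 0) :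
    1 / (g 0) ^ 2 - 1 / (g' 0) ^ 2 ≤ (2 / (1 + θ)) ^ K * (1 / (g K) ^ 2 - 1 / (g' K) ^ 2) := by
  have hρ : 0 < (1 + θ) / 2 := by linarith
  rcases lt_or_eq_of_le h0 with hlt | heq
  · have h := sep_lower hθ0 hθ1 hC hg hg' hbox hbox' hL hΛ hsmall hlt le_rfl (j := K)
    have hρK : 0 < ((1 + θ) / 2) ^ K := pow_pos hρ K
    rw [show (2 : ℝ) / (1 + θ) = 1 / ((1 + θ) / 2) by field_simp, one_div_pow, one_div_mul_eq_div, le_div_iff₀ hρK,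
      mul_comm]
    exact h
  · have hall := fwd_unique hg hg' (fun i hi => (hbox i hi).1) (fun i hi => (hbox' i hi).1) heq K le_rfl
    rw [heq, hall, sub_self, sub_self, mul_zero]

/-- **END — «g₀(ε, ·)» EXISTS, IS UNIQUE AND STRICTLY INCREASING, SIGN-FREE.**  `Theorem2Statement S hL` AS TYPED (a HYPOTHESIS), the printed `Definitions`,
the upper letter (U) `β_{k+1} ≤ b′` on ]0, γ_u]^{k+1} (to put (0.20) on in-interval runs), coupling-chart moduli `HistLipschitz Λ γ_u S.β` with `FadingMemory C θ Λ`
(0 ≤ θ < 1, 0 ≤ C) and one box size γ₁ ≤ γ_u with b′γ₁² < 1, 4Cγ₁³ ≤ (1 − θ)² ⟹ for every m there is γ₂ > 0 such that for every γ ≤ γ₂ there is g₁ > 0 such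
that for all 0 < g < g̃ ≤ g₁ and EVERY K: the tuned bare couplings g₀ of g and g̃₀ of g̃ exist, are unique among in-]0, γ]-interval runs, and g₀ < g̃₀.
Prover 1's #62g `theorem2_bareCoupling_lipschitz` (monotone AND 2-Lipschitz, under `BetaLowerH b` + smallness in b) minus its AF letters keeps exactly the
monotonicity. A REDUCTION over UNPRINTED letters; nothing of [I] asserted. [cite: Balaban1987RG1, Thm 2 (0.31) p.259 with (0.20) p.256, §1 p.264 and p.298] -/
theorem theorem2_bareCoupling_strictMono_signFree {hL : Odd S.L ∧ 1 < S.L} (h : Theorem2Statement S hL) (hD : Definitions S)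
    {γu γ₁ b' θ C : ℝ} {Λ : ℕ → ℕ → ℝ} (hup : BetaUpperH b' γu S.β)
    (hL' : HistLipschitz Λ γu S.β) (hΛ : FadingMemory C θ Λ) (hθ0 : 0 ≤ θ) (hθ1 : θ < 1) (hC : 0 ≤ C)
    (hγ₁ : 0 < γ₁) (hγ₁u : γ₁ ≤ γu) (hbu : b' * γ₁ ^ 2 < 1) (hsmall : 4 * C * γ₁ ^ 3 ≤ (1 - θ) ^ 2) (m : ℕ) :
    ∃ γ₂ : ℝ, 0 < γ₂ ∧ ∀ γ : ℝ, 0 < γ → γ ≤ γ₂ → ∃ g₁ : ℝ, 0 < g₁ ∧ ∀ g g₂ : ℝ, 0 < g → g < g₂ → g₂ ≤ g₁ → ∀ K : ℕ,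
      ∃ g₀ g₀' : ℝ, g₀ < g₀' ∧ (Step.InInterval γ K (S.cpl ⟨K, m, g₀⟩) ∧ S.cpl ⟨K, m, g₀⟩ K = g) ∧
        (Step.InInterval γ K (S.cpl ⟨K, m, g₀'⟩) ∧ S.cpl ⟨K, m, g₀'⟩ K = g₂) ∧
        ∀ y y' : ℝ, Step.InInterval γ K (S.cpl ⟨K, m, y⟩) → S.cpl ⟨K, m, y⟩ K = g →
          Step.InInterval γ K (S.cpl ⟨K, m, y'⟩) → S.cpl ⟨K, m, y'⟩ K = g₂ → y = g₀ ∧ y' = g₀' := by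
  obtain ⟨γ₀, hγ₀, hγ⟩ := tunedRuns_of_theorem2Statement h m
  refine ⟨min γ₀ γ₁, lt_min hγ₀ hγ₁, fun γ hγpos hγle => ?_⟩
  have hγ₀le : γ ≤ γ₀ := hγle.trans (min_le_left _ _)
  have hγ₁le : γ ≤ γ₁ := hγle.trans (min_le_right _ _)
  have hγule : γ ≤ γu := hγ₁le.trans hγ₁u
  obtain ⟨g₁, hg₁, hg⟩ := hγ γ hγpos hγ₀le
  refine ⟨g₁, hg₁, fun g g₂ hgpos hlt hg₂le K => ?_⟩
  have hg₂pos : 0 < g₂ := hgpos.trans hlt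
  obtain ⟨β₁, β₁', -, -, hK₁⟩ := hg g hgpos (hlt.le.trans hg₂le)
  obtain ⟨β₂, β₂', -, -, hK₂⟩ := hg g₂ hg₂pos hg₂le
  obtain ⟨g₀, hI, hend, -⟩ := hK₁ K
  obtain ⟨g₀', hI', hend', -⟩ := hK₂ K
  have hup' : BetaUpperH b' γ S.β := fun k v hv => hup k v (box_mono hγule k hv)
  have hLγ : HistLipschitz Λ γ S.β := fun k p q hp hq => hL' k p q (box_mono hγule k hp) (box_mono hγule k hq)
  have hγsq : γ ^ 2 ≤ γ₁ ^ 2 := pow_le_pow_left₀ hγpos.le hγ₁le 2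
  have hbγ : b' * γ ^ 2 < 1 := by
    rcases le_or_gt 0 b' with hb' | hb'
    · exact lt_of_le_of_lt (mul_le_mul_of_nonneg_left hγsq hb') hbu
    · nlinarith [sq_nonneg γ]
  have hsmallγ : 4 * C * γ ^ 3 ≤ (1 - θ) ^ 2 :=
    (mul_le_mul_of_nonneg_left (pow_le_pow_left₀ hγpos.le hγ₁le 3) (by positivity)).trans hsmall
  have hrg : ∀ y : ℝ, Step.InInterval γ K (S.cpl ⟨K, m, y⟩) → RGEqH K S.β (S.cpl ⟨K, m, y⟩) :=
    fun y hIy => hrg_of_betaUpperH hD hγpos hup' hbγ ⟨K, m, y⟩ hIy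
  have huniq : ∀ y z x : ℝ, Step.InInterval γ K (S.cpl ⟨K, m, y⟩) → S.cpl ⟨K, m, y⟩ K = x →
      Step.InInterval γ K (S.cpl ⟨K, m, z⟩) → S.cpl ⟨K, m, z⟩ K = x → y = z :=
    fun y z x hIy hy hIz hz => (bareCoupling_unique_signFree hD hθ0 hθ1 hC hLγ hΛ hsmallγ (hrg y hIy) (hrg z hIz)
      hIy hIz (hy.trans hz.symm)).1
  have hord : g₀ < g₀' := (bare_lt_iff_renormalized_lt hD hθ0 hθ1 hC hLγ hΛ hsmallγ (hrg g₀ hI) (hrg g₀' hI') hI hI').mpr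
    (by rw [hend, hend']; exact hlt)
  exact ⟨g₀, g₀', hord, ⟨hI, hend⟩, ⟨hI', hend'⟩, fun y y' hIy hy hIy' hy' =>
    ⟨huniq y g₀ g hIy hy hI hend, huniq y' g₀' g₂ hIy' hy' hI' hend'⟩⟩

end

end Summit.QuantumFields.BalabanUV.Beta.EriceFlowEnclosureB12AsPrintedPointwiseFadingOrderEnd
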